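import Summits.KontsevichZagierPeriods.KontsevichZagierPeriods.Theorems.IsogenyCertificatesXMapKernelQuasiEngineCore

/-!
# `XMapKernel` (stmt-KontsevichZagierPeriods-10663), line `derived-datum-quasi-periods` — stub `stub_quasiTransferEngine` (the ENGINE)

The registered stub `stub_quasiTransferEngine` of the line `derived-datum-quasi-periods` of the crux
`IsogenyCertificates.XMapKernel` (lead prover): from the derived datum identity DD (stub 1), the weighted
cell move (stub 2, rule 2 per cell of the egg) and the rational Hermite move (stub 3, rule 3), taken as
hypotheses,

* (a) the egg representations `[egg(A,B), (a₀ + a₁x)/√P]` exist (`QuasiEngine.exists_eggRep`), and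
* (b) QUASI-PERIODS TRANSFER along every egg-regular coprime x-rational isogeny datum between
  three-real-root integral cubics, IN BOTH DIRECTIONS: `∀ b₀ b₁ ∃ a₀ a₁` and `∀ a₀ a₁ ∃ b₀ b₁` with
  `[egg, (a₀ + a₁x)/√P] ∼ [egg′, (b₀ + b₁X)/√Q]` — `QuasiEngine.engine_core` gives the first direction
  with the explicit coefficients `(a₀, a₁) = ((|c|b₀ + b₁α/|c|)/m, b₁β/(|c|m))`, and `β ≠ 0` (DD),
  `c ≠ 0`, `m ≥ 1` make `(b₀, b₁) ↦ (a₀, a₁)` onto `ℚ²`, which is the second.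

This is the (ω, η)-version of the sibling crux `XMapPeriodTransfer`: the isogeny, read through its x-map
on the real egg, IS the certificate for the quasi-period relation `m·H′ = ±(αΩ + βH)` as well.

References: M. Kontsevich, D. Zagier, *Periods* (2001), §1.2; N. D. Elkies (1998), §3; J. H. Silverman,
*The Arithmetic of Elliptic Curves* (2009), III.4–III.6.
-/

noncomputable section

open Set Filter MeasureTheory Polynomial Topology
open scoped BigOperators
open Literature.NumberTheory.Transcendental
open Literature.ModelTheory.ExponentialFields (IsSemialgebraic)

namespace Summit.KontsevichZagierPeriods.IsogenyCertificates.XMapKernelStubs.QuasiEngine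

/-- **Registered stub `stub_quasiTransferEngine`** (lead): egg representations exist, and quasi-periods
transfer both ways along every egg-regular coprime datum, from DD + the weighted cell move + the
rational Hermite move. [cite: KontsevichZagier2001, §1.2] -/
theorem stub_quasiTransferEngine :
    (∀ (A B A' B' : ℤ) (f g : ℚ[X]) (c : ℚ),
      4 * A ^ 3 + 27 * B ^ 2 ≠ 0 → 4 * A' ^ 3 + 27 * B' ^ 2 ≠ 0 → IsCoprime f g →
      derivative f * g - f * derivative g ≠ 0 →
      C (c ^ 2) * g * (f ^ 3 + C (A' : ℚ) * f * g ^ 2 + C (B' : ℚ) * g ^ 3) =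
        (X ^ 3 + C (A : ℚ) * X + C (B : ℚ)) * (derivative f * g - f * derivative g) ^ 2 →
      ∃ α β : ℚ, β ≠ 0 ∧
        C (c ^ 2) * f * g + C 2 * (X ^ 3 + C (A : ℚ) * X + C (B : ℚ)) *
            (g * derivative (derivative g) - derivative g ^ 2) +
          derivative (X ^ 3 + C (A : ℚ) * X + C (B : ℚ)) * g * derivative g =
        (C α + C β * X) * g ^ 2) →
    (∀ (A B A' B' : ℤ) (f g : ℚ[X]) (c : ℚ),
      derivative f * g - f * derivative g ≠ 0 →
      C (c ^ 2) * g * (f ^ 3 + C (A' : ℚ) * f * g ^ 2 + C (B' : ℚ) * g ^ 3) =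
        (X ^ 3 + C (A : ℚ) * X + C (B : ℚ)) * (derivative f * g - f * derivative g) ^ 2 →
      ∀ (R W : ℝ → ℝ) (L : Set ℝ), R = (fun y => aeval y f / aeval y g) →
        W = (fun y => aeval y (derivative f * g - f * derivative g)) →
        L = {y : ℝ | 0 < y ^ 3 + (A : ℝ) * y + (B : ℝ) ∧ W y ≠ 0} →
      ∀ x₀ ∈ L, InjOn R (connectedComponentIn L x₀) → (∀ y ∈ connectedComponentIn L x₀, aeval y g ≠ 0) →
        ∀ (b₀ b₁ : ℚ) (rI t : KZ.IntegralRep 1),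
          rI.domain = {x | x 0 ∈ connectedComponentIn L x₀} →
          EqOn rI.integrand (fun x => |(c : ℝ)| * ((b₀ : ℝ) + (b₁ : ℝ) * R (x 0)) /
            Real.sqrt (x 0 ^ 3 + (A : ℝ) * x 0 + (B : ℝ))) rI.domain →
          t.domain = {x | x 0 ∈ R '' connectedComponentIn L x₀} →
          EqOn t.integrand (fun x => ((b₀ : ℝ) + (b₁ : ℝ) * x 0) /
            Real.sqrt (x 0 ^ 3 + (A' : ℝ) * x 0 + (B' : ℝ))) t.domain →
          KZ.of rI - KZ.of t ∈ KZ.relations) →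
    (∀ (A B : ℤ) (u g : ℚ[X]), 4 * A ^ 3 + 27 * B ^ 2 < 0 →
      ∀ (E : Set ℝ), E = {y : ℝ | 0 < y ^ 3 + (A : ℝ) * y + (B : ℝ)} \
        connectedComponentIn {y : ℝ | 0 < y ^ 3 + (A : ℝ) * y + (B : ℝ)} (1 + |(A : ℝ)| + |(B : ℝ)|) →
      (∀ y ∈ closure E, aeval y g ≠ 0) →
      ∀ r : KZ.IntegralRep 1, r.domain = {x | x 0 ∈ E} →
        EqOn r.integrand (fun x =>
          (2 * (x 0 ^ 3 + (A : ℝ) * x 0 + (B : ℝ)) *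
              (aeval (x 0) (derivative u) * aeval (x 0) g - aeval (x 0) u * aeval (x 0) (derivative g)) +
            (3 * x 0 ^ 2 + (A : ℝ)) * aeval (x 0) u * aeval (x 0) g) /
          (2 * (aeval (x 0) g) ^ 2 * Real.sqrt (x 0 ^ 3 + (A : ℝ) * x 0 + (B : ℝ)))) r.domain →
        KZ.of r ∈ KZ.relations) →
    (∀ (A B : ℤ) (a₀ a₁ : ℚ), 4 * A ^ 3 + 27 * B ^ 2 < 0 → ∃ r : KZ.IntegralRep 1,
      r.domain = {x | x 0 ∈ {y : ℝ | 0 < y ^ 3 + (A : ℝ) * y + (B : ℝ)} \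
        connectedComponentIn {y : ℝ | 0 < y ^ 3 + (A : ℝ) * y + (B : ℝ)} (1 + |(A : ℝ)| + |(B : ℝ)|)} ∧
      r.integrand = fun x => ((a₀ : ℝ) + (a₁ : ℝ) * x 0) / Real.sqrt (x 0 ^ 3 + (A : ℝ) * x 0 + (B : ℝ))) ∧
    (∀ (A B A' B' : ℤ), 4 * A ^ 3 + 27 * B ^ 2 < 0 → 4 * A' ^ 3 + 27 * B' ^ 2 < 0 →
      (∃ (f g : ℚ[X]) (c : ℚ), IsCoprime f g ∧ derivative f * g - f * derivative g ≠ 0 ∧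
        C (c ^ 2) * g * (f ^ 3 + C (A' : ℚ) * f * g ^ 2 + C (B' : ℚ) * g ^ 3) =
          (X ^ 3 + C (A : ℚ) * X + C (B : ℚ)) * (derivative f * g - f * derivative g) ^ 2 ∧
        ∀ y ∈ closure ({y : ℝ | 0 < y ^ 3 + (A : ℝ) * y + (B : ℝ)} \
          connectedComponentIn {y : ℝ | 0 < y ^ 3 + (A : ℝ) * y + (B : ℝ)} (1 + |(A : ℝ)| + |(B : ℝ)|)),
          aeval y g ≠ 0) →
      (∀ b₀ b₁ : ℚ, ∃ a₀ a₁ : ℚ, ∀ (r r' : KZ.IntegralRep 1),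
        r.domain = {x | x 0 ∈ {y : ℝ | 0 < y ^ 3 + (A : ℝ) * y + (B : ℝ)} \
          connectedComponentIn {y : ℝ | 0 < y ^ 3 + (A : ℝ) * y + (B : ℝ)} (1 + |(A : ℝ)| + |(B : ℝ)|)} →
        EqOn r.integrand (fun x => ((a₀ : ℝ) + (a₁ : ℝ) * x 0) /
          Real.sqrt (x 0 ^ 3 + (A : ℝ) * x 0 + (B : ℝ))) r.domain →
        r'.domain = {x | x 0 ∈ {y : ℝ | 0 < y ^ 3 + (A' : ℝ) * y + (B' : ℝ)} \
          connectedComponentIn {y : ℝ | 0 < y ^ 3 + (A' : ℝ) * y + (B' : ℝ)} (1 + |(A' : ℝ)| + |(B' : ℝ)|)} →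
        EqOn r'.integrand (fun x => ((b₀ : ℝ) + (b₁ : ℝ) * x 0) /
          Real.sqrt (x 0 ^ 3 + (A' : ℝ) * x 0 + (B' : ℝ))) r'.domain →
        KZ.Equivalent r r') ∧
      (∀ a₀ a₁ : ℚ, ∃ b₀ b₁ : ℚ, ∀ (r r' : KZ.IntegralRep 1),
        r.domain = {x | x 0 ∈ {y : ℝ | 0 < y ^ 3 + (A : ℝ) * y + (B : ℝ)} \
          connectedComponentIn {y : ℝ | 0 < y ^ 3 + (A : ℝ) * y + (B : ℝ)} (1 + |(A : ℝ)| + |(B : ℝ)|)} →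
        EqOn r.integrand (fun x => ((a₀ : ℝ) + (a₁ : ℝ) * x 0) /
          Real.sqrt (x 0 ^ 3 + (A : ℝ) * x 0 + (B : ℝ))) r.domain →
        r'.domain = {x | x 0 ∈ {y : ℝ | 0 < y ^ 3 + (A' : ℝ) * y + (B' : ℝ)} \
          connectedComponentIn {y : ℝ | 0 < y ^ 3 + (A' : ℝ) * y + (B' : ℝ)} (1 + |(A' : ℝ)| + |(B' : ℝ)|)} →
        EqOn r'.integrand (fun x => ((b₀ : ℝ) + (b₁ : ℝ) * x 0) /
          Real.sqrt (x 0 ^ 3 + (A' : ℝ) * x 0 + (B' : ℝ))) r'.domain →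
        KZ.Equivalent r r')) := by
  intro hDD hMove hHermite
  refine ⟨exists_eggRep, fun A B A' B' hΔ hΔ' hJ => ?_⟩
  obtain ⟨f, g, c, hcop, hW, hI, hreg⟩ := hJ
  obtain ⟨α, β, hβ, hDDfg⟩ := hDD A B A' B' f g c hΔ.ne hΔ'.ne hcop hW hI
  obtain ⟨m, hm, hcore⟩ := engine_core hMove hHermite A B A' B' hΔ hΔ' f g c hcop hW hI hreg α β hDDfg
  obtain ⟨-, hc⟩ := XMapPeriodTransferDatum.g_ne_zero_and_c_ne_zero hW hI
  have hc' : (|c| : ℚ) ≠ 0 := abs_ne_zero.mpr hc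
  have hm' : (m : ℚ) ≠ 0 := by exact_mod_cast hm.ne'
  constructor
  · intro b₀ b₁
    exact ⟨((|c|) * b₀ + b₁ * α / (|c|)) / m, (b₁ * β / (|c|)) / m,
      fun r r' hr hri hr' hr'i => hcore b₀ b₁ r r' hr hri hr' hr'i⟩
  · intro a₀ a₁
    refine ⟨(a₀ * m - (a₁ * |c| * m / β) * α / |c|) / |c|, a₁ * |c| * m / β,
      fun r r' hr hri hr' hr'i => hcore _ _ r r' hr ?_ hr' hr'i⟩
    have e0 : ((|c|) * ((a₀ * m - (a₁ * |c| * m / β) * α / |c|) / |c|) +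
        (a₁ * |c| * m / β) * α / (|c|)) / m = a₀ := by
      field_simp
      ring
    have e1 : ((a₁ * |c| * m / β) * β / (|c|)) / m = a₁ := by
      field_simp
    intro x hx
    rw [hri hx, e0, e1]

end Summit.KontsevichZagierPeriods.IsogenyCertificates.XMapKernelStubs.QuasiEngine

end
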